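/-
Copyright (c) 2026 the pub-hodgecm-mathlib formalisation cell (harness21).  Prover seat hodgecm-mathlib-LH7-p09 (g3), CLOSE-OUT ROSTER strike line L3∕L5 (Track A
«(D-RAM) FOUR-FRAME» squad F0∕P3c∕LH4 ∕ F0∕P3c∕LH7); β₂ WORD #30∕#34∕#36 «LH7-p09: hL_mix_hi» (lower line, MIX-hi strip `d ≤ b ≤ 2d − 2`); helper lane on
h413 = stmt-HodgeConjecture-24833 (count-neutral).  2026-09-05.
-/
import Summits.HodgeConjecture.HodgeConjecture.Theorems.F0P3cDyRamRowCellGeneratorIndependence   -- ★ p864148 (LH7-p06 (g3)): §4 `cls_iff_cls_of_gen`, §2 `digit_mul_sub_digit`, §1 `normTheta_gen_mul`; brings ★ `trace_letters`, ★ `exists_isOrd_mul_of_presentations`, ★ `v_eq_one_of_isOrd_of_mul_eq_one`, ★ DEFS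
import Literature.NumberTheory.LocalFields.WildQuadraticDatumTraceBound                        -- ★ Lit: `trace_bound_pow_of_isRamifiedQuadraticDatum` (`|w + Θw| ≤ |ϖM|^{d−1}·|w|` on `M`)
import HarnessLib

/-!
# Crux `H413`, line LH4 «(D-RAM) FOUR-FRAME» — STAGE-1b, row (2), the (β₂) road (R-36): «THE DIGIT OF `κ̂` OF A ROW CELL MEMBER MOVES BELOW `|jEϖ|^{b+d−1}` UNDER A
# CHANGE OF GENERATOR» — ★ p864148 §5∕§6 SHARPENED by the `Θ`-trace gain on `M` (the transfer letter of the lower line's MIX-hi strip `d ≤ b ≤ 2d − 2`)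

Cell `hodgecm-mathlib` (D-0151), FLOOR 0, crux item H413 = `stmt-HodgeConjecture-24833`, route of record `HCCMUnconditional`; squad F0∕P3c∕LH4 ∕ LH7; lane
`--supports stmt-HodgeConjecture-24833 --as helper` (count-neutral; pays NO tier-0 row).  THEOREMS ONLY (no `def`, no instance, no notation, no `sorry`, default heartbeats);
★-only imports; states NO law; (β₂) stays a HYPOTHESIS.  Frame = ★ p864148's (§5: `jE`-letters `hjfix`, `jEϖ ≠ 0`, `|jEϖ| ≤ 1`, `ρ, Θ` commuting involutive isometries of
`M`, `Θh = h`, the cell `(j, b)` with `1 ≤ b`, `cc(α − ρα) ≠ 0`, the gap letter `hFgap`, ★ p863914 §1's reference pair `κ₀, ξ₀ ≠ 0` with `hR`; §6 adds the `E`-side datum,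
`hα hα1 hint`, `d ≤ b ≤ j`, `hdeep`) PLUS the `M`-side datum `IsRamifiedQuadraticDatum Θ (jE ϖ) d tM` (the block's `_hDM`), used ONLY through ★ Lit
`trace_bound_pow_of_isRamifiedQuadraticDatum`.

WHY (β₂ WORD #30∕#34∕#36, β₂ sub-dealer LH4-p04 (g10) 02:08:26Z (b) «road A = LH4-p19 (g3)'s R2 worker with `hdb : d ≤ b`»).  LH4-p19's literal reads transfer the sphere
`|γ₁(V − W₁)| = 1` and the sign `ω(γ₁(V − W₁))` from the presentation generator `x₁` of a glued vertex to the socket's generator `x₀` through ★ p864148 §5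
`|Vf x₁ − Vf x₀| ≤ |jEϖ|^b` and a digit letter `|γ₁|·|jEϖ|^b ≤ |jEϖ|^{2d−1}` (★ `…UpperRayCellLiteralReads`).  On the LOWER line `|γ₁| = |cc(α − ρα)|·|ξ₀|·|jEϖ|^{−b}`
(`= 1` at `|ξ₀| = R = |jEϖ|^b ∕ |cc(α − ρα)|`), so that letter reads `b ≥ 2d − 1` — the RAY band only.  THIS FILE removes the obstruction on the MIX-hi strip: the skew of
`N = zΘz` (`z` the order unit with `x₀′ = x₀·z`, `δ = z − ρz`, `|δ| ≤ |cc(α − ρα)|`) is `N − ρN = Tr_Θ(z·Θδ) − δ·Θδ` (§1), and `Tr_Θ` GAINS `d − 1` digits on `M`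
(★ Lit, Serre III §3 Prop. 7: `Tr 𝔭_M^k ⊆ 𝔭_M^{k+d−1}`), so `|N − ρN| ≤ |cc(α − ρα)|·max(|jEϖ|^{d−1}, |cc(α − ρα)|)` instead of ★ §5's `|cc(α − ρα)|`; hence
`|κ̂′ − κ̂|·|cc(α − ρα)| ≤ |jEϖ|^{2b}·max(|jEϖ|^{d−1}, |cc(α − ρα)|)` (§2, reference-pair free) and `|Vf x₀′ − Vf x₀| ≤ |jEϖ|^b·max(…) ≤ |jEϖ|^{b+d−1}` once
`|cc(α − ρα)| ≤ |jEϖ|^{d−1}` (automatic for `d ≤ b ≤ j`, `|α| ≤ 1`) (§3).  With `|γ₁| = 1` the transfer now needs `b + d − 1 ≥ 2d − 1 ⟺ d ≤ b`: the WHOLE strip.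
* §1 `normTheta_sub_map_eq_trace_sub` (the identity), `v_normTheta_sub_map_le_sharp` (its size under the `M`-datum);
* §2 `v_digit_sub_digit_mul_le_sharp_of_gen` (pair-free digit part); §3 `v_coord_sub_coord_mul_le_sharp_of_gen` (normalisation-free: `|ΔVf|·|ξ₀|·|cc(α − ρα)| ≤ …`, no `hR`),
  `v_coord_sub_coord_le_sharp_of_gen` (max form under `hR`), `v_coord_sub_coord_le_pow_of_gen` (`|jEϖ|^{b+d−1}` under `hR` and `|cc(α − ρα)| ≤ |jEϖ|^{d−1}`);
* §4 HEADS = ★ p864148 §6 with the sharp radius: `cls_iff_cls_and_v_sub_le_robust_of_gen` (no `hR`; any `r` with `|jEϖ|^{2b}·|jEϖ|^{d−1} ≤ r·|ξ₀|·|cc(α − ρα)|` — the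
  form robust to the parity of `|ξ₀| ∕ R`) and `cls_iff_cls_and_v_sub_le_sharp_of_gen` (`hR`; any `r ≥ |jEϖ|^{b+d−1}`); class part = ★ `cls_iff_cls_of_gen` by name.
WHAT IS NOT CLAIMED: (hLit), (hF), (hbase), the `hdeep` letter, the lower-line size `|γ₁| = 1`, any read, any count.
HONEST LABEL.  Count-neutral field ∕ valuation algebra; nothing printed is asserted; no census law is stated; `HC_CM` is proved only modulo the 7 printed citations (2 remaining named
inputs: hLiu418 = `stmt-HodgeConjecture-24832`, h413 = `stmt-HodgeConjecture-24833`) until rung 0 closes.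
## References
* [Serre1979] J.-P. Serre, *Local Fields*, GTM 67 (1979): Ch. III §3 Prop. 7 (trace ideals `Tr 𝔭^k ⊆ 𝔭_F^{⌊(k+d)∕2⌋}`), Ch. III §6 Prop. 12–13 (orders `𝒪_E + c𝒪_M`, the different),
  Ch. V §3 Cor. 3 (norms near 1).
* [Jacobowitz1962] R. Jacobowitz, *Hermitian forms over local fields*, Amer. J. Math. 84 (1962): §4 (dual lattices, gluing).
* [Kottwitz1986BaseChangeUnits] R. E. Kottwitz, *Base change for unit elements of Hecke algebras*, Compositio Math. 60 (1986): §1 pp. 240–241 (fixed-lattice counts).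
-/

set_option autoImplicit false

noncomputable section

namespace Summit.HodgeConjecture.HodgeConjecture.Cruxes.H413.F0P3cDyRamRowCellGeneratorIndependenceSharp

open scoped Valued WithZero
open WithZero
open Literature.NumberTheory.Automorphic.UnitaryThreeFourFrame (IsRamifiedQuadraticDatum)
open Literature.NumberTheory.LocalFields.WildQuadraticDatum (trace_bound_pow_of_isRamifiedQuadraticDatum)
open Summit.HodgeConjecture.HodgeConjecture.Cruxes.H413.F0P3cDyRamToricCensusDefs
open Summit.HodgeConjecture.HodgeConjecture.Cruxes.H413.F0P3cDyRamDiagonalCellGeneratorChange (exists_isOrd_mul_of_presentations)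
open Summit.HodgeConjecture.HodgeConjecture.Cruxes.H413.F0P3cDyRamDiagonalCellGeneratorIndependence (v_eq_one_of_isOrd_of_mul_eq_one)
open Summit.HodgeConjecture.HodgeConjecture.Cruxes.H413.F0P3cDyRamRowCellFibreTransport (trace_letters)
open Summit.HodgeConjecture.HodgeConjecture.Cruxes.H413.F0P3cDyRamRowCellGeneratorIndependence (normTheta_gen_mul digit_mul_sub_digit cls_iff_cls_of_gen)

variable {E M : Type} [Field E] [Valued E ℤᵐ⁰] [Field M] [Valued M ℤᵐ⁰] {ρ Θ : M →+* M} {α : M}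

/-! ## §1 The skew of a `Θ`-norm is a `Θ`-trace minus a square -/
omit [Valued E ℤᵐ⁰] [Valued M ℤᵐ⁰] in
/-- **`zΘz − ρ(zΘz) = Tr_Θ(z·Θδ) − δ·Θδ`, `δ = z − ρz`** (`Θ` an involution commuting with `ρ`): the skew of a `Θ`-norm is a `Θ`-TRACE (which gains `d − 1` digits) minus the
`Θ`-norm of the skew (which is quadratically small). [cite: Serre1979, Ch. III §3 Prop. 7] -/
theorem normTheta_sub_map_eq_trace_sub (hΘΘ : ∀ x, Θ (Θ x) = x) (hΘρ : ∀ x, Θ (ρ x) = ρ (Θ x)) (z : M) :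
    z * Θ z - ρ (z * Θ z) = (z * Θ (z - ρ z) + Θ (z * Θ (z - ρ z))) - (z - ρ z) * Θ (z - ρ z) := by
  rw [map_mul ρ, ← hΘρ, map_mul Θ, hΘΘ, map_sub Θ]; ring

omit [Valued E ℤᵐ⁰] in
/-- **THE SHARP SKEW SIZE OF A `Θ`-NORM**: under the `M`-side datum `IsRamifiedQuadraticDatum Θ ϖM d t` (trace gain ★ Lit `|w + Θw| ≤ |ϖM|^{d−1}·|w|`), for every `z`:
`|zΘz − ρ(zΘz)| ≤ max(|ϖM|^{d−1}·|z|·|z − ρz|, |z − ρz|²)` — versus the order bound `|z − ρz|·|z|` of ★ `v_normTheta_sub_map_le`. [cite: Serre1979, Ch. III §3 Prop. 7; Ch. III §6 Prop. 13] -/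
theorem v_normTheta_sub_map_le_sharp {ϖM : M} {d t : ℕ} (hDM : IsRamifiedQuadraticDatum Θ ϖM d t) (hΘρ : ∀ x, Θ (ρ x) = ρ (Θ x)) (z : M) :
    Valued.v (z * Θ z - ρ (z * Θ z)) ≤
      max (Valued.v ϖM ^ (d - 1) * (Valued.v z * Valued.v (z - ρ z))) (Valued.v (z - ρ z) * Valued.v (z - ρ z)) := by
  have hΘΘ : ∀ x, Θ (Θ x) = x := hDM.1
  have hvΘ : ∀ x, Valued.v (Θ x) = Valued.v x := hDM.2.1
  rw [normTheta_sub_map_eq_trace_sub hΘΘ hΘρ z]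
  refine (Valuation.map_sub _ _ _).trans (max_le_max ?_ ?_)
  · exact (trace_bound_pow_of_isRamifiedQuadraticDatum hDM _).trans (by rw [Valuation.map_mul, hvΘ])
  · rw [Valuation.map_mul, hvΘ]

/-! ## §2 THE SHARP DIGIT PART, reference-pair free: `|κ̂′ − κ̂|·|cc(α − ρα)| ≤ |jEϖ|^{2b}·max(|jEϖ|^{d−1}, |cc(α − ρα)|)` -/
omit [Valued E ℤᵐ⁰] in
/-- **SHARP DIGIT PART, PAIR-FREE — «THE DIGIT `κ̂ = ρu₀∕Tr_ρ u₀` MOVES BY `|u₀|²·|N − ρN|` AND THE SKEW OF `N` GAINS `d − 1` DIGITS».**  Frame of ★ p864148 §5 (no reference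
pair) + the `M`-side datum `IsRamifiedQuadraticDatum Θ (jE ϖ) d tM`.  THEN for two generators `x₀, x₀′` of one `Λ` with the five `GEN` clauses, `u = h·xΘx`, `κ̂(x) = ρu∕(u + ρu)`:
`|κ̂(x₀′) − κ̂(x₀)|·|cc(α − ρα)| ≤ |jEϖ|^{2b}·max(|jEϖ|^{d−1}, |cc(α − ρα)|)` (`x₀′ = x₀z`, `u₀′ = u₀·zΘz`, ★ `digit_mul_sub_digit`, `|Tr_ρ u₀| = |Tr_ρ u₀′| = 1` by ★ `trace_letters`,
§1 at the order unit `z`, `|u₀|·|cc(α − ρα)| = |Y| = |jEϖ|^b`). [cite: Serre1979, Ch. III §3 Prop. 7; Ch. III §6 Prop. 12] [cite: Jacobowitz1962, §4] [cite: Kottwitz1986BaseChangeUnits, §1 pp. 240–241] -/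
theorem v_digit_sub_digit_mul_le_sharp_of_gen
    (jE : E →+* M) (hjfix : ∀ z, ρ z = z ↔ ∃ c, jE c = z) {ϖ : E} (hjϖ0 : jE ϖ ≠ 0) (hjϖ1 : Valued.v (jE ϖ) ≤ 1)
    (hρρ : ∀ x, ρ (ρ x) = x) (hvρ : ∀ x, Valued.v (ρ x) = Valued.v x) (hΘΘ : ∀ x, Θ (Θ x) = x) (hΘρ : ∀ x, Θ (ρ x) = ρ (Θ x))
    {d tM : ℕ} (hDM : IsRamifiedQuadraticDatum Θ (jE ϖ) d tM)
    {hM : M} (hΘh : Θ hM = hM) {j b : ℕ} (hb1 : 1 ≤ b) (hcc : jE ϖ ^ j * (α - ρ α) ≠ 0)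
    (hFgap : ∀ z : M, ρ z = z → Θ z = z → Valued.v (jE ϖ) < Valued.v z → Valued.v z ≤ 1 → Valued.v z = 1)
    (Λ : AddSubgroup M) (x₀ x₀' : M)
    (hG : x₀ ≠ 0 ∧ (∀ x, x ∈ Λ ↔ ∃ ζ, IsOrd ρ α (jE ϖ ^ j) ζ ∧ x = x₀ * ζ) ∧
      IsOrd ρ α (jE ϖ ^ j) (dualGen ρ Θ α (jE ϖ ^ j) hM x₀) ∧ ¬ IsOrd ρ α (jE ϖ ^ j) (dualGen ρ Θ α (jE ϖ ^ j) hM x₀ / jE ϖ) ∧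
      Valued.v (dualGen ρ Θ α (jE ϖ ^ j) hM x₀) = Valued.v (jE ϖ) ^ b)
    (hG' : x₀' ≠ 0 ∧ (∀ x, x ∈ Λ ↔ ∃ ζ, IsOrd ρ α (jE ϖ ^ j) ζ ∧ x = x₀' * ζ) ∧
      IsOrd ρ α (jE ϖ ^ j) (dualGen ρ Θ α (jE ϖ ^ j) hM x₀') ∧ ¬ IsOrd ρ α (jE ϖ ^ j) (dualGen ρ Θ α (jE ϖ ^ j) hM x₀' / jE ϖ) ∧
      Valued.v (dualGen ρ Θ α (jE ϖ ^ j) hM x₀') = Valued.v (jE ϖ) ^ b) :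
    Valued.v (ρ (hM * (x₀' * Θ x₀')) / (hM * (x₀' * Θ x₀') + ρ (hM * (x₀' * Θ x₀'))) -
        ρ (hM * (x₀ * Θ x₀)) / (hM * (x₀ * Θ x₀) + ρ (hM * (x₀ * Θ x₀)))) * Valued.v (jE ϖ ^ j * (α - ρ α)) ≤
      Valued.v (jE ϖ) ^ (2 * b) * max (Valued.v (jE ϖ) ^ (d - 1)) (Valued.v (jE ϖ ^ j * (α - ρ α))) := by
  have hρj : ∀ c : E, ρ (jE c) = jE c := fun c => (hjfix _).2 ⟨c, rfl⟩
  obtain ⟨hx₀, hΛ, hyO, hyprim, hylev⟩ := hG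
  obtain ⟨hx₀', hΛ', hyO', hyprim', hylev'⟩ := hG'
  obtain ⟨-, -, ht1⟩ := trace_letters (α := α) hρρ hΘΘ hΘρ hΘh (hρj ϖ) hjϖ0 hjϖ1 hb1 hcc hFgap hyO hyprim hylev
  obtain ⟨-, -, ht'1⟩ := trace_letters (α := α) hρρ hΘΘ hΘρ hΘh (hρj ϖ) hjϖ0 hjϖ1 hb1 hcc hFgap hyO' hyprim' hylev'
  have hu₀v : Valued.v (hM * (x₀ * Θ x₀)) * Valued.v (jE ϖ ^ j * (α - ρ α)) = Valued.v (jE ϖ) ^ b := by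
    rw [← Valuation.map_mul, ← dualGen_def, hylev]
  -- `x₀′ = x₀·z`, `u₀′ = u₀·N`, `N = zΘz`
  obtain ⟨z, z', hz, hz', hx₀z, hzz'⟩ := exists_isOrd_mul_of_presentations hx₀ hΛ hΛ'
  have hz1 : Valued.v z = 1 := v_eq_one_of_isOrd_of_mul_eq_one hz hz' hzz'
  have hu₀' : hM * (x₀' * Θ x₀') = hM * (x₀ * Θ x₀) * (z * Θ z) := by rw [hx₀z, normTheta_gen_mul]
  rw [hu₀'] at ht'1 ⊢
  set u₀ : M := hM * (x₀ * Θ x₀) with hu₀def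
  set N : M := z * Θ z with hNdef
  set A : M := jE ϖ ^ j * (α - ρ α) with hAdef
  set mx : ℤᵐ⁰ := max (Valued.v (jE ϖ) ^ (d - 1)) (Valued.v A) with hmxdef
  have ht0 : u₀ + ρ u₀ ≠ 0 := fun h0 => by rw [h0, map_zero] at ht1; exact zero_ne_one ht1
  have ht'0 : u₀ * N + ρ (u₀ * N) ≠ 0 := fun h0 => by rw [h0, map_zero] at ht'1; exact zero_ne_one ht'1
  -- the exact change of the digit and its size
  rw [digit_mul_sub_digit hρρ ht0 ht'0]
  simp only [map_div₀, Valuation.map_mul, hvρ, ht1, ht'1, mul_one, div_one]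
  -- the SHARP skew size: `|ρN − N| ≤ |A|·max(|jEϖ|^{d−1}, |A|)`
  have hskew : Valued.v (ρ N - N) ≤ Valued.v A * mx := by
    rw [← Valuation.map_neg, neg_sub, hNdef]
    refine (v_normTheta_sub_map_le_sharp hDM hΘρ z).trans (max_le ?_ ?_)
    · rw [hz1, one_mul, mul_comm]
      exact mul_le_mul' hz.2 (le_max_left _ _)
    · exact mul_le_mul' hz.2 (hz.2.trans (le_max_right _ _))
  calc Valued.v u₀ * Valued.v u₀ * Valued.v (ρ N - N) * Valued.v A ≤ Valued.v u₀ * Valued.v u₀ * (Valued.v A * mx) * Valued.v A := by gcongr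
    _ = (Valued.v u₀ * Valued.v A) * (Valued.v u₀ * Valued.v A) * mx := by ac_rfl
    _ = Valued.v (jE ϖ) ^ (2 * b) * mx := by rw [hu₀v, ← pow_add, two_mul]

/-! ## §3 THE SHARP DIGIT PART in ★ p863914's coordinate `Vf = (κ̂ − κ₀)∕ξ₀` -/
omit [Valued E ℤᵐ⁰] in
/-- **SHARP DIGIT PART, NORMALISATION-FREE — «`|Vf x₀′ − Vf x₀|·|ξ₀|·|cc(α − ρα)| ≤ |jEϖ|^{2b}·max(|jEϖ|^{d−1}, |cc(α − ρα)|)`».**  Frame of ★ p864148 §5 with the reference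
pair `κ₀`, `ξ₀ ≠ 0` but WITHOUT the radius letter `hR`: §2 divided by `ξ₀`.  This is the form the lower line wants: its `|γ₁| = |cc(α − ρα)|·|ξ₀|·|jEϖ|^{−b}` makes
`|γ₁|·|Vf x₀′ − Vf x₀| ≤ |jEϖ|^b·max(…)` whatever the parity of `|ξ₀| ∕ R`. [cite: Serre1979, Ch. III §3 Prop. 7; Ch. III §6 Prop. 12] [cite: Jacobowitz1962, §4] [cite: Kottwitz1986BaseChangeUnits, §1 pp. 240–241] -/
theorem v_coord_sub_coord_mul_le_sharp_of_gen
    (jE : E →+* M) (hjfix : ∀ z, ρ z = z ↔ ∃ c, jE c = z) {ϖ : E} (hjϖ0 : jE ϖ ≠ 0) (hjϖ1 : Valued.v (jE ϖ) ≤ 1)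
    (hρρ : ∀ x, ρ (ρ x) = x) (hvρ : ∀ x, Valued.v (ρ x) = Valued.v x) (hΘΘ : ∀ x, Θ (Θ x) = x) (hΘρ : ∀ x, Θ (ρ x) = ρ (Θ x))
    {d tM : ℕ} (hDM : IsRamifiedQuadraticDatum Θ (jE ϖ) d tM)
    {hM : M} (hΘh : Θ hM = hM) {j b : ℕ} (hb1 : 1 ≤ b) (hcc : jE ϖ ^ j * (α - ρ α) ≠ 0)
    (hFgap : ∀ z : M, ρ z = z → Θ z = z → Valued.v (jE ϖ) < Valued.v z → Valued.v z ≤ 1 → Valued.v z = 1)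
    (κ₀ : M) {ξ₀ : M} (hξ0 : ξ₀ ≠ 0)
    (Λ : AddSubgroup M) (x₀ x₀' : M)
    (hG : x₀ ≠ 0 ∧ (∀ x, x ∈ Λ ↔ ∃ ζ, IsOrd ρ α (jE ϖ ^ j) ζ ∧ x = x₀ * ζ) ∧
      IsOrd ρ α (jE ϖ ^ j) (dualGen ρ Θ α (jE ϖ ^ j) hM x₀) ∧ ¬ IsOrd ρ α (jE ϖ ^ j) (dualGen ρ Θ α (jE ϖ ^ j) hM x₀ / jE ϖ) ∧
      Valued.v (dualGen ρ Θ α (jE ϖ ^ j) hM x₀) = Valued.v (jE ϖ) ^ b)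
    (hG' : x₀' ≠ 0 ∧ (∀ x, x ∈ Λ ↔ ∃ ζ, IsOrd ρ α (jE ϖ ^ j) ζ ∧ x = x₀' * ζ) ∧
      IsOrd ρ α (jE ϖ ^ j) (dualGen ρ Θ α (jE ϖ ^ j) hM x₀') ∧ ¬ IsOrd ρ α (jE ϖ ^ j) (dualGen ρ Θ α (jE ϖ ^ j) hM x₀' / jE ϖ) ∧
      Valued.v (dualGen ρ Θ α (jE ϖ ^ j) hM x₀') = Valued.v (jE ϖ) ^ b) :
    Valued.v ((ρ (hM * (x₀' * Θ x₀')) / (hM * (x₀' * Θ x₀') + ρ (hM * (x₀' * Θ x₀'))) - κ₀) / ξ₀ -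
        (ρ (hM * (x₀ * Θ x₀)) / (hM * (x₀ * Θ x₀) + ρ (hM * (x₀ * Θ x₀))) - κ₀) / ξ₀) * Valued.v ξ₀ * Valued.v (jE ϖ ^ j * (α - ρ α)) ≤
      Valued.v (jE ϖ) ^ (2 * b) * max (Valued.v (jE ϖ) ^ (d - 1)) (Valued.v (jE ϖ ^ j * (α - ρ α))) := by
  have hdig := v_digit_sub_digit_mul_le_sharp_of_gen jE hjfix hjϖ0 hjϖ1 hρρ hvρ hΘΘ hΘρ hDM hΘh hb1 hcc hFgap Λ x₀ x₀' hG hG'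
  have e0 : (ρ (hM * (x₀' * Θ x₀')) / (hM * (x₀' * Θ x₀') + ρ (hM * (x₀' * Θ x₀'))) - κ₀) / ξ₀ -
        (ρ (hM * (x₀ * Θ x₀)) / (hM * (x₀ * Θ x₀) + ρ (hM * (x₀ * Θ x₀))) - κ₀) / ξ₀ =
      (ρ (hM * (x₀' * Θ x₀')) / (hM * (x₀' * Θ x₀') + ρ (hM * (x₀' * Θ x₀'))) -
        ρ (hM * (x₀ * Θ x₀)) / (hM * (x₀ * Θ x₀) + ρ (hM * (x₀ * Θ x₀)))) / ξ₀ := by ring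
  rwa [e0, map_div₀, div_mul_cancel₀ _ ((Valuation.ne_zero_iff _).2 hξ0)]

omit [Valued E ℤᵐ⁰] in
/-- **SHARP DIGIT PART — «THE COORDINATE OF `κ̂` MOVES BELOW `|jEϖ|^b·max(|jEϖ|^{d−1}, |cc(α − ρα)|)`».**  Frame of ★ p864148 §5 VERBATIM (reference pair `κ₀`, `ξ₀ ≠ 0`,
radius letter `hR : |jEϖ|^b ≤ |ξ₀|·|cc(α − ρα)|`) + the `M`-side datum.  THEN `|Vf x₀′ − Vf x₀| ≤ |jEϖ|^b·max(|jEϖ|^{d−1}, |cc(α − ρα)|)` (§2 and `hR`).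
[cite: Serre1979, Ch. III §3 Prop. 7; Ch. III §6 Prop. 12] [cite: Jacobowitz1962, §4] [cite: Kottwitz1986BaseChangeUnits, §1 pp. 240–241] -/
theorem v_coord_sub_coord_le_sharp_of_gen
    (jE : E →+* M) (hjfix : ∀ z, ρ z = z ↔ ∃ c, jE c = z) {ϖ : E} (hjϖ0 : jE ϖ ≠ 0) (hjϖ1 : Valued.v (jE ϖ) ≤ 1)
    (hρρ : ∀ x, ρ (ρ x) = x) (hvρ : ∀ x, Valued.v (ρ x) = Valued.v x) (hΘΘ : ∀ x, Θ (Θ x) = x) (hΘρ : ∀ x, Θ (ρ x) = ρ (Θ x))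
    {d tM : ℕ} (hDM : IsRamifiedQuadraticDatum Θ (jE ϖ) d tM)
    {hM : M} (hΘh : Θ hM = hM) {j b : ℕ} (hb1 : 1 ≤ b) (hcc : jE ϖ ^ j * (α - ρ α) ≠ 0)
    (hFgap : ∀ z : M, ρ z = z → Θ z = z → Valued.v (jE ϖ) < Valued.v z → Valued.v z ≤ 1 → Valued.v z = 1)
    (κ₀ : M) {ξ₀ : M} (hξ0 : ξ₀ ≠ 0) (hR : Valued.v (jE ϖ) ^ b ≤ Valued.v ξ₀ * Valued.v (jE ϖ ^ j * (α - ρ α)))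
    (Λ : AddSubgroup M) (x₀ x₀' : M)
    (hG : x₀ ≠ 0 ∧ (∀ x, x ∈ Λ ↔ ∃ ζ, IsOrd ρ α (jE ϖ ^ j) ζ ∧ x = x₀ * ζ) ∧
      IsOrd ρ α (jE ϖ ^ j) (dualGen ρ Θ α (jE ϖ ^ j) hM x₀) ∧ ¬ IsOrd ρ α (jE ϖ ^ j) (dualGen ρ Θ α (jE ϖ ^ j) hM x₀ / jE ϖ) ∧
      Valued.v (dualGen ρ Θ α (jE ϖ ^ j) hM x₀) = Valued.v (jE ϖ) ^ b)
    (hG' : x₀' ≠ 0 ∧ (∀ x, x ∈ Λ ↔ ∃ ζ, IsOrd ρ α (jE ϖ ^ j) ζ ∧ x = x₀' * ζ) ∧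
      IsOrd ρ α (jE ϖ ^ j) (dualGen ρ Θ α (jE ϖ ^ j) hM x₀') ∧ ¬ IsOrd ρ α (jE ϖ ^ j) (dualGen ρ Θ α (jE ϖ ^ j) hM x₀' / jE ϖ) ∧
      Valued.v (dualGen ρ Θ α (jE ϖ ^ j) hM x₀') = Valued.v (jE ϖ) ^ b) :
    Valued.v ((ρ (hM * (x₀' * Θ x₀')) / (hM * (x₀' * Θ x₀') + ρ (hM * (x₀' * Θ x₀'))) - κ₀) / ξ₀ -
        (ρ (hM * (x₀ * Θ x₀)) / (hM * (x₀ * Θ x₀) + ρ (hM * (x₀ * Θ x₀))) - κ₀) / ξ₀) ≤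
      Valued.v (jE ϖ) ^ b * max (Valued.v (jE ϖ) ^ (d - 1)) (Valued.v (jE ϖ ^ j * (α - ρ α))) := by
  have hAv : (0 : ℤᵐ⁰) < Valued.v (jE ϖ ^ j * (α - ρ α)) := zero_lt_iff.2 ((Valuation.ne_zero_iff _).2 hcc)
  have hξv : (0 : ℤᵐ⁰) < Valued.v ξ₀ := zero_lt_iff.2 ((Valuation.ne_zero_iff _).2 hξ0)
  have hdig := v_digit_sub_digit_mul_le_sharp_of_gen jE hjfix hjϖ0 hjϖ1 hρρ hvρ hΘΘ hΘρ hDM hΘh hb1 hcc hFgap Λ x₀ x₀' hG hG'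
  have e0 : (ρ (hM * (x₀' * Θ x₀')) / (hM * (x₀' * Θ x₀') + ρ (hM * (x₀' * Θ x₀'))) - κ₀) / ξ₀ -
        (ρ (hM * (x₀ * Θ x₀)) / (hM * (x₀ * Θ x₀) + ρ (hM * (x₀ * Θ x₀))) - κ₀) / ξ₀ =
      (ρ (hM * (x₀' * Θ x₀')) / (hM * (x₀' * Θ x₀') + ρ (hM * (x₀' * Θ x₀'))) -
        ρ (hM * (x₀ * Θ x₀)) / (hM * (x₀ * Θ x₀) + ρ (hM * (x₀ * Θ x₀)))) / ξ₀ := by ring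
  rw [e0, map_div₀, div_le_iff₀ hξv]
  refine le_of_mul_le_mul_right ?_ hAv
  calc Valued.v (ρ (hM * (x₀' * Θ x₀')) / (hM * (x₀' * Θ x₀') + ρ (hM * (x₀' * Θ x₀'))) -
          ρ (hM * (x₀ * Θ x₀)) / (hM * (x₀ * Θ x₀) + ρ (hM * (x₀ * Θ x₀)))) * Valued.v (jE ϖ ^ j * (α - ρ α))
        ≤ Valued.v (jE ϖ) ^ (2 * b) * max (Valued.v (jE ϖ) ^ (d - 1)) (Valued.v (jE ϖ ^ j * (α - ρ α))) := hdig
    _ = Valued.v (jE ϖ) ^ b * max (Valued.v (jE ϖ) ^ (d - 1)) (Valued.v (jE ϖ ^ j * (α - ρ α))) * Valued.v (jE ϖ) ^ b := by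
          rw [two_mul, pow_add]; ac_rfl
    _ ≤ Valued.v (jE ϖ) ^ b * max (Valued.v (jE ϖ) ^ (d - 1)) (Valued.v (jE ϖ ^ j * (α - ρ α))) *
          (Valued.v ξ₀ * Valued.v (jE ϖ ^ j * (α - ρ α))) := by gcongr
    _ = Valued.v (jE ϖ) ^ b * max (Valued.v (jE ϖ) ^ (d - 1)) (Valued.v (jE ϖ ^ j * (α - ρ α))) * Valued.v ξ₀ *
          Valued.v (jE ϖ ^ j * (α - ρ α)) := by ac_rfl

omit [Valued E ℤᵐ⁰] in
/-- **SHARP DIGIT PART AT THE GLUE CONDUCTOR — «THE COORDINATE MOVES BELOW `|jEϖ|^{b+d−1}`».**  §3's frame + the letter `|cc(α − ρα)| ≤ |jEϖ|^{d−1}` (automatic for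
`d − 1 ≤ j`, `|α| ≤ 1`).  THEN `|Vf x₀′ − Vf x₀| ≤ |jEϖ|^{b+d−1}` — ★ p864148 §5's conclusion with `b + d − 1` for `b`: with the lower line's `|γ₁| = 1` the sphere∕sign
transfer letter `|γ₁|·(this) ≤ |jEϖ|^{2d−1}` reads `d ≤ b`. [cite: Serre1979, Ch. III §3 Prop. 7; Ch. III §6 Prop. 12; Ch. V §3 Cor. 3] [cite: Kottwitz1986BaseChangeUnits, §1 pp. 240–241] -/
theorem v_coord_sub_coord_le_pow_of_gen
    (jE : E →+* M) (hjfix : ∀ z, ρ z = z ↔ ∃ c, jE c = z) {ϖ : E} (hjϖ0 : jE ϖ ≠ 0) (hjϖ1 : Valued.v (jE ϖ) ≤ 1)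
    (hρρ : ∀ x, ρ (ρ x) = x) (hvρ : ∀ x, Valued.v (ρ x) = Valued.v x) (hΘΘ : ∀ x, Θ (Θ x) = x) (hΘρ : ∀ x, Θ (ρ x) = ρ (Θ x))
    {d tM : ℕ} (hDM : IsRamifiedQuadraticDatum Θ (jE ϖ) d tM)
    {hM : M} (hΘh : Θ hM = hM) {j b : ℕ} (hb1 : 1 ≤ b) (hcc : jE ϖ ^ j * (α - ρ α) ≠ 0)
    (hjd : Valued.v (jE ϖ ^ j * (α - ρ α)) ≤ Valued.v (jE ϖ) ^ (d - 1))
    (hFgap : ∀ z : M, ρ z = z → Θ z = z → Valued.v (jE ϖ) < Valued.v z → Valued.v z ≤ 1 → Valued.v z = 1)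
    (κ₀ : M) {ξ₀ : M} (hξ0 : ξ₀ ≠ 0) (hR : Valued.v (jE ϖ) ^ b ≤ Valued.v ξ₀ * Valued.v (jE ϖ ^ j * (α - ρ α)))
    (Λ : AddSubgroup M) (x₀ x₀' : M)
    (hG : x₀ ≠ 0 ∧ (∀ x, x ∈ Λ ↔ ∃ ζ, IsOrd ρ α (jE ϖ ^ j) ζ ∧ x = x₀ * ζ) ∧
      IsOrd ρ α (jE ϖ ^ j) (dualGen ρ Θ α (jE ϖ ^ j) hM x₀) ∧ ¬ IsOrd ρ α (jE ϖ ^ j) (dualGen ρ Θ α (jE ϖ ^ j) hM x₀ / jE ϖ) ∧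
      Valued.v (dualGen ρ Θ α (jE ϖ ^ j) hM x₀) = Valued.v (jE ϖ) ^ b)
    (hG' : x₀' ≠ 0 ∧ (∀ x, x ∈ Λ ↔ ∃ ζ, IsOrd ρ α (jE ϖ ^ j) ζ ∧ x = x₀' * ζ) ∧
      IsOrd ρ α (jE ϖ ^ j) (dualGen ρ Θ α (jE ϖ ^ j) hM x₀') ∧ ¬ IsOrd ρ α (jE ϖ ^ j) (dualGen ρ Θ α (jE ϖ ^ j) hM x₀' / jE ϖ) ∧
      Valued.v (dualGen ρ Θ α (jE ϖ ^ j) hM x₀') = Valued.v (jE ϖ) ^ b) :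
    Valued.v ((ρ (hM * (x₀' * Θ x₀')) / (hM * (x₀' * Θ x₀') + ρ (hM * (x₀' * Θ x₀'))) - κ₀) / ξ₀ -
        (ρ (hM * (x₀ * Θ x₀)) / (hM * (x₀ * Θ x₀) + ρ (hM * (x₀ * Θ x₀))) - κ₀) / ξ₀) ≤ Valued.v (jE ϖ) ^ (b + d - 1) := by
  have h1d : 1 ≤ d := hDM.2.2.2.2.2.1
  refine (v_coord_sub_coord_le_sharp_of_gen jE hjfix hjϖ0 hjϖ1 hρρ hvρ hΘΘ hΘρ hDM hΘh hb1 hcc hFgap κ₀ hξ0 hR Λ x₀ x₀' hG hG').trans ?_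
  rw [max_eq_left hjd, ← pow_add, show b + (d - 1) = b + d - 1 by omega]

/-! ## §4 HEADS — ★ p864148 §6 with the sharp radius -/
/-- **HEAD, NORMALISATION-FREE FORM — THE (hI) LETTER AT ANY RADIUS `r` WITH `|jEϖ|^{2b}·|jEϖ|^{d−1} ≤ r·|ξ₀|·|cc(α − ρα)|` (normalisation-free).**  Frame of ★ p864148 §6 (`E`-side datum, `jE`-letters,
`ρ, Θ` commuting involutive isometries, `hα hα1 hint`, `Θh = h`, the cell `(j, b)` with `1 ≤ b`, `d ≤ b`, `b ≤ j`, `cc(α − ρα) ≠ 0`, `hFgap`, `hdeep`, the reference pair `κ₀`,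
`ξ₀ ≠ 0`) WITHOUT `hR`, + the `M`-side datum `IsRamifiedQuadraticDatum Θ (jE ϖ) d tM`, and any `r` with `|jEϖ|^{2b}·|jEϖ|^{d−1} ≤ r·(|ξ₀|·|cc(α − ρα)|)` (at `|ξ₀| = R`:
`r ≥ |jEϖ|^{b+d−1}`; at `|ξ₀| = R∕|jEϖ|`: `r ≥ |jEϖ|^{b+d}`).  THEN for all `Λ x₀ x₀′` with the five `GEN` clauses at both: `(CLS x₀ ↔ CLS x₀′) ∧ |Vf x₀′ − Vf x₀| ≤ r` —
class part ★ `cls_iff_cls_of_gen` by name, digit part §3 `v_coord_sub_coord_mul_le_sharp_of_gen` (`|cc(α − ρα)| ≤ |jEϖ|^j ≤ |jEϖ|^{d−1}` from `d ≤ b ≤ j`, `|α| ≤ 1`).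
[cite: Serre1979, Ch. III §3 Prop. 7; Ch. III §6 Prop. 12; Ch. V §3 Cor. 3] [cite: Kottwitz1986BaseChangeUnits, §1 pp. 240–241] [cite: Jacobowitz1962, §4] -/
theorem cls_iff_cls_and_v_sub_le_robust_of_gen {σ : E →+* E} {ϖ : E} {d tE : ℕ} (hD : IsRamifiedQuadraticDatum σ ϖ d tE)
    (jE : E →+* M) (hjv : ∀ c, Valued.v (jE c) ≤ 1 ↔ Valued.v c ≤ 1) (hjfix : ∀ z, ρ z = z ↔ ∃ c, jE c = z) (hΘj : ∀ c, Θ (jE c) = jE (σ c))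
    (hρρ : ∀ x, ρ (ρ x) = x) (hvρ : ∀ x, Valued.v (ρ x) = Valued.v x) (hΘΘ : ∀ x, Θ (Θ x) = x) (hΘρ : ∀ x, Θ (ρ x) = ρ (Θ x))
    (hvΘ : ∀ x, Valued.v (Θ x) = Valued.v x) {tM : ℕ} (hDM : IsRamifiedQuadraticDatum Θ (jE ϖ) d tM)
    (hα : ρ α ≠ α) (hα1 : Valued.v α ≤ 1) (hint : ∀ z : M, Valued.v z ≤ 1 → Valued.v ((z - ρ z) / (α - ρ α)) ≤ 1)
    {hM : M} (hΘh : Θ hM = hM) {j b : ℕ} (hb1 : 1 ≤ b) (hdb : d ≤ b) (hbj : b ≤ j) (hcc : jE ϖ ^ j * (α - ρ α) ≠ 0)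
    (hFgap : ∀ z : M, ρ z = z → Θ z = z → Valued.v (jE ϖ) < Valued.v z → Valued.v z ≤ 1 → Valued.v z = 1)
    (hdeep : ∀ u : M, ρ u = u → Θ u = u → Valued.v (u - 1) ≤ Valued.v (jE ϖ) ^ (2 * d) → ∃ c : M, ρ c = c ∧ c * Θ c = u)
    (κ₀ : M) {ξ₀ : M} (hξ0 : ξ₀ ≠ 0)
    (r : ℤᵐ⁰) (hr : Valued.v (jE ϖ) ^ (2 * b) * Valued.v (jE ϖ) ^ (d - 1) ≤ r * (Valued.v ξ₀ * Valued.v (jE ϖ ^ j * (α - ρ α))))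
    (Λ : AddSubgroup M) (x₀ x₀' : M)
    (hG : x₀ ≠ 0 ∧ (∀ x, x ∈ Λ ↔ ∃ ζ, IsOrd ρ α (jE ϖ ^ j) ζ ∧ x = x₀ * ζ) ∧
      IsOrd ρ α (jE ϖ ^ j) (dualGen ρ Θ α (jE ϖ ^ j) hM x₀) ∧ ¬ IsOrd ρ α (jE ϖ ^ j) (dualGen ρ Θ α (jE ϖ ^ j) hM x₀ / jE ϖ) ∧
      Valued.v (dualGen ρ Θ α (jE ϖ ^ j) hM x₀) = Valued.v (jE ϖ) ^ b)
    (hG' : x₀' ≠ 0 ∧ (∀ x, x ∈ Λ ↔ ∃ ζ, IsOrd ρ α (jE ϖ ^ j) ζ ∧ x = x₀' * ζ) ∧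
      IsOrd ρ α (jE ϖ ^ j) (dualGen ρ Θ α (jE ϖ ^ j) hM x₀') ∧ ¬ IsOrd ρ α (jE ϖ ^ j) (dualGen ρ Θ α (jE ϖ ^ j) hM x₀' / jE ϖ) ∧
      Valued.v (dualGen ρ Θ α (jE ϖ ^ j) hM x₀') = Valued.v (jE ϖ) ^ b) :
    ((∃ e : M, ρ e = e ∧ e * Θ e = hM * (x₀ * Θ x₀) + ρ (hM * (x₀ * Θ x₀))) ↔
        (∃ e : M, ρ e = e ∧ e * Θ e = hM * (x₀' * Θ x₀') + ρ (hM * (x₀' * Θ x₀')))) ∧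
      Valued.v ((ρ (hM * (x₀' * Θ x₀')) / (hM * (x₀' * Θ x₀') + ρ (hM * (x₀' * Θ x₀'))) - κ₀) / ξ₀ -
        (ρ (hM * (x₀ * Θ x₀)) / (hM * (x₀ * Θ x₀) + ρ (hM * (x₀ * Θ x₀))) - κ₀) / ξ₀) ≤ r := by
  have hϖ : Valued.v ϖ = exp (-1 : ℤ) := hD.2.2.1
  have hvϖ0 : Valued.v ϖ ≠ 0 := by rw [hϖ]; exact exp_ne_zero
  have hϖ0 : ϖ ≠ 0 := fun h0 => by rw [h0, map_zero] at hvϖ0; exact hvϖ0 rfl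
  have hϖ1 : Valued.v ϖ ≤ 1 := by rw [hϖ, ← exp_zero, exp_le_exp]; norm_num
  have hjϖ0 : jE ϖ ≠ 0 := (map_ne_zero jE).2 hϖ0
  have hjϖ1 : Valued.v (jE ϖ) ≤ 1 := (hjv ϖ).2 hϖ1
  have hAv : (0 : ℤᵐ⁰) < Valued.v (jE ϖ ^ j * (α - ρ α)) := zero_lt_iff.2 ((Valuation.ne_zero_iff _).2 hcc)
  have hξv : (0 : ℤᵐ⁰) < Valued.v ξ₀ := zero_lt_iff.2 ((Valuation.ne_zero_iff _).2 hξ0)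
  -- `|cc(α − ρα)| ≤ |jEϖ|^j ≤ |jEϖ|^{d−1}`
  have hjd : Valued.v (jE ϖ ^ j * (α - ρ α)) ≤ Valued.v (jE ϖ) ^ (d - 1) := by
    have hA1 : Valued.v (α - ρ α) ≤ 1 := (Valuation.map_sub _ _ _).trans (max_le hα1 (by rw [hvρ]; exact hα1))
    rw [Valuation.map_mul, Valuation.map_pow]
    exact (mul_le_of_le_one_right' hA1).trans (pow_le_pow_right_of_le_one' hjϖ1 (by omega))
  refine ⟨cls_iff_cls_of_gen hD jE hjv hjfix hΘj hρρ hvρ hΘΘ hΘρ hvΘ hα hα1 hint hΘh hb1 hdb hbj hcc hFgap hdeep Λ x₀ x₀' hG hG', ?_⟩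
  have hmul := v_coord_sub_coord_mul_le_sharp_of_gen jE hjfix hjϖ0 hjϖ1 hρρ hvρ hΘΘ hΘρ hDM hΘh hb1 hcc hFgap κ₀ hξ0 Λ x₀ x₀' hG hG'
  rw [max_eq_left hjd] at hmul
  refine le_of_mul_le_mul_right (a := Valued.v ξ₀ * Valued.v (jE ϖ ^ j * (α - ρ α))) ?_ (mul_pos hξv hAv)
  rw [← mul_assoc]
  exact hmul.trans hr

/-- **HEAD — THE (hI) LETTER AT ANY RADIUS `r ≥ |jEϖ|^{b+d−1}`.**  Frame of ★ p864148 §6 VERBATIM (`E`-side datum, `jE`-letters, `ρ, Θ` commuting involutive isometries,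
`hα hα1 hint`, `Θh = h`, the cell `(j, b)` with `1 ≤ b`, `d ≤ b`, `b ≤ j`, `cc(α − ρα) ≠ 0`, `hFgap`, `hdeep`, the reference pair `κ₀`, `ξ₀ ≠ 0`, `hR`) + the `M`-side datum
`IsRamifiedQuadraticDatum Θ (jE ϖ) d tM`, and any `r` with `|jEϖ|^{b+d−1} ≤ r` (★ §6 needed `|jEϖ|^b ≤ r`).  THEN for all `Λ x₀ x₀′` with the five `GEN` clauses at both:
`(CLS x₀ ↔ CLS x₀′) ∧ |Vf x₀′ − Vf x₀| ≤ r` — class part ★ `cls_iff_cls_of_gen` by name, digit part §3 (`|cc(α − ρα)| ≤ |jEϖ|^j ≤ |jEϖ|^{d−1}` from `d ≤ b ≤ j`, `|α| ≤ 1`).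
[cite: Serre1979, Ch. III §3 Prop. 7; Ch. III §6 Prop. 12; Ch. V §3 Cor. 3] [cite: Kottwitz1986BaseChangeUnits, §1 pp. 240–241] [cite: Jacobowitz1962, §4] -/
theorem cls_iff_cls_and_v_sub_le_sharp_of_gen {σ : E →+* E} {ϖ : E} {d tE : ℕ} (hD : IsRamifiedQuadraticDatum σ ϖ d tE)
    (jE : E →+* M) (hjv : ∀ c, Valued.v (jE c) ≤ 1 ↔ Valued.v c ≤ 1) (hjfix : ∀ z, ρ z = z ↔ ∃ c, jE c = z) (hΘj : ∀ c, Θ (jE c) = jE (σ c))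
    (hρρ : ∀ x, ρ (ρ x) = x) (hvρ : ∀ x, Valued.v (ρ x) = Valued.v x) (hΘΘ : ∀ x, Θ (Θ x) = x) (hΘρ : ∀ x, Θ (ρ x) = ρ (Θ x))
    (hvΘ : ∀ x, Valued.v (Θ x) = Valued.v x) {tM : ℕ} (hDM : IsRamifiedQuadraticDatum Θ (jE ϖ) d tM)
    (hα : ρ α ≠ α) (hα1 : Valued.v α ≤ 1) (hint : ∀ z : M, Valued.v z ≤ 1 → Valued.v ((z - ρ z) / (α - ρ α)) ≤ 1)
    {hM : M} (hΘh : Θ hM = hM) {j b : ℕ} (hb1 : 1 ≤ b) (hdb : d ≤ b) (hbj : b ≤ j) (hcc : jE ϖ ^ j * (α - ρ α) ≠ 0)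
    (hFgap : ∀ z : M, ρ z = z → Θ z = z → Valued.v (jE ϖ) < Valued.v z → Valued.v z ≤ 1 → Valued.v z = 1)
    (hdeep : ∀ u : M, ρ u = u → Θ u = u → Valued.v (u - 1) ≤ Valued.v (jE ϖ) ^ (2 * d) → ∃ c : M, ρ c = c ∧ c * Θ c = u)
    (κ₀ : M) {ξ₀ : M} (hξ0 : ξ₀ ≠ 0) (hR : Valued.v (jE ϖ) ^ b ≤ Valued.v ξ₀ * Valued.v (jE ϖ ^ j * (α - ρ α)))
    (r : ℤᵐ⁰) (hr : Valued.v (jE ϖ) ^ (b + d - 1) ≤ r)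
    (Λ : AddSubgroup M) (x₀ x₀' : M)
    (hG : x₀ ≠ 0 ∧ (∀ x, x ∈ Λ ↔ ∃ ζ, IsOrd ρ α (jE ϖ ^ j) ζ ∧ x = x₀ * ζ) ∧
      IsOrd ρ α (jE ϖ ^ j) (dualGen ρ Θ α (jE ϖ ^ j) hM x₀) ∧ ¬ IsOrd ρ α (jE ϖ ^ j) (dualGen ρ Θ α (jE ϖ ^ j) hM x₀ / jE ϖ) ∧
      Valued.v (dualGen ρ Θ α (jE ϖ ^ j) hM x₀) = Valued.v (jE ϖ) ^ b)
    (hG' : x₀' ≠ 0 ∧ (∀ x, x ∈ Λ ↔ ∃ ζ, IsOrd ρ α (jE ϖ ^ j) ζ ∧ x = x₀' * ζ) ∧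
      IsOrd ρ α (jE ϖ ^ j) (dualGen ρ Θ α (jE ϖ ^ j) hM x₀') ∧ ¬ IsOrd ρ α (jE ϖ ^ j) (dualGen ρ Θ α (jE ϖ ^ j) hM x₀' / jE ϖ) ∧
      Valued.v (dualGen ρ Θ α (jE ϖ ^ j) hM x₀') = Valued.v (jE ϖ) ^ b) :
    ((∃ e : M, ρ e = e ∧ e * Θ e = hM * (x₀ * Θ x₀) + ρ (hM * (x₀ * Θ x₀))) ↔
        (∃ e : M, ρ e = e ∧ e * Θ e = hM * (x₀' * Θ x₀') + ρ (hM * (x₀' * Θ x₀')))) ∧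
      Valued.v ((ρ (hM * (x₀' * Θ x₀')) / (hM * (x₀' * Θ x₀') + ρ (hM * (x₀' * Θ x₀'))) - κ₀) / ξ₀ -
        (ρ (hM * (x₀ * Θ x₀)) / (hM * (x₀ * Θ x₀) + ρ (hM * (x₀ * Θ x₀))) - κ₀) / ξ₀) ≤ r := by
  have hϖ : Valued.v ϖ = exp (-1 : ℤ) := hD.2.2.1
  have hvϖ0 : Valued.v ϖ ≠ 0 := by rw [hϖ]; exact exp_ne_zero
  have hϖ0 : ϖ ≠ 0 := fun h0 => by rw [h0, map_zero] at hvϖ0; exact hvϖ0 rfl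
  have hϖ1 : Valued.v ϖ ≤ 1 := by rw [hϖ, ← exp_zero, exp_le_exp]; norm_num
  have hjϖ0 : jE ϖ ≠ 0 := (map_ne_zero jE).2 hϖ0
  have hjϖ1 : Valued.v (jE ϖ) ≤ 1 := (hjv ϖ).2 hϖ1
  -- `|cc(α − ρα)| ≤ |jEϖ|^j ≤ |jEϖ|^{d−1}`
  have hjd : Valued.v (jE ϖ ^ j * (α - ρ α)) ≤ Valued.v (jE ϖ) ^ (d - 1) := by
    have hA1 : Valued.v (α - ρ α) ≤ 1 := (Valuation.map_sub _ _ _).trans (max_le hα1 (by rw [hvρ]; exact hα1))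
    rw [Valuation.map_mul, Valuation.map_pow]
    exact (mul_le_of_le_one_right' hA1).trans (pow_le_pow_right_of_le_one' hjϖ1 (by omega))
  exact ⟨cls_iff_cls_of_gen hD jE hjv hjfix hΘj hρρ hvρ hΘΘ hΘρ hvΘ hα hα1 hint hΘh hb1 hdb hbj hcc hFgap hdeep Λ x₀ x₀' hG hG',
    (v_coord_sub_coord_le_pow_of_gen jE hjfix hjϖ0 hjϖ1 hρρ hvρ hΘΘ hΘρ hDM hΘh hb1 hcc hjd hFgap κ₀ hξ0 hR Λ x₀ x₀' hG hG').trans hr⟩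

end Summit.HodgeConjecture.HodgeConjecture.Cruxes.H413.F0P3cDyRamRowCellGeneratorIndependenceSharp

end
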